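import Mathlib.RingTheory.Valuation.ValuationSubring
import Mathlib.GroupTheory.OrderOfElement
import HarnessLib

/-!
# Overrings of a valuation ring and automorphisms (Engler–Prestel Ch. 3; Kuhlmann 2010/2011)

Topic: `Literature/AlgebraicGeometry/Resolution` (valued function fields). Elementary facts about
the valuation subrings `U ⊇ W` of a field `N` coarsening a given valuation subring `W`
("overrings", "coarsenings") and about automorphisms `g` of `N` of finite order acting on
them, which are the tools of the proof (files `ValuationAlgebraicExtension.lean`,
`DecompositionFieldCoarsening.lean`, `DecompositionFieldApprox.lean`) that the decomposition
field of a valued finite Galois extension is approximated to first order by the base field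
(F.-V. Kuhlmann, *Approximation of elements in henselizations*, Manuscripta Math. 136 (2011),
Thm. 1.1), whence the henselization is an immediate extension (Kuhlmann 2010, Lemma 2.2,
`Kuhlmann2010HenselizationImmediate` in `Henselization.lean`).

## Content (all PROVED)

* `overring_le_or_ge` — the overrings of `W` are totally ordered (Mathlib's
  `ValuationSubring.le_total_ideal`, unbundled); `valuation_lt_one_of_le_of_lt_one` (`𝔪_U ⊆ 𝔪_W` for
  `W ≤ U`), `valuation_le_valuation_of_le` / `valuation_lt_of_lt_of_le` (coarsening is monotone on values).
* `smul_eq_of_smul_le`, `smul_eq_of_le_smul` — for `g` of finite order, `g • U ≤ U` (or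
  `U ≤ g • U`) forces `g • U = U`; `smul_eq_of_le_of_smul_le` — if `U` contains both `W` and
  `g • W` then `g` stabilises `U`; `mem_stabilizer_of_le` — the stabiliser (decomposition group)
  grows along coarsenings (Kuhlmann 2011, proof of Lemma 2.1: "`v ∘ σ = v` implies
  `w ∘ σ = w`").
* `valuation_smul_le_valuation_smul_iff`, `valuation_smul_eq` — an automorphism of finite order
  stabilising `U` preserves the valuation of `U` EXACTLY (Kiyek–Vicente I (8.3)(5)/(8.4): an
  order automorphism of finite order of a totally ordered group is the identity); in particular
  `g • a / a` is a unit of `U`.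
* `exists_mem_not_mem_div_not_mem` — the "large elements" lemma: if `V ≤ W'`, `e ∈ W' ∖ V`, and
  a subring `R` is contained in no valuation ring `U` with `V ≤ U < W'`, then some `x ∈ R` has
  `x ∉ V` and `x / e ∉ V` (i.e. `v(x) > v(e)`): the radical `𝔮` of `e⁻¹V` is a prime of `V`
  whose localisation `V_𝔮` lies strictly below `W'`, so some `x ∈ R` lies outside `V_𝔮`, i.e.
  `x⁻¹ ∈ 𝔮`, `xⁿ⁺¹/e ∈ V`-dominates; replaces the approximation theorem for independent
  valuations in the rank-`> 1` setting.

## Sources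

* F.-V. Kuhlmann, *Approximation of elements in henselizations*, Manuscripta Math. 136 (2011)
  461–474 = arXiv:1003.5674, §2 (coarsenings `v_Δ`, Lemma 2.1) and §4. [Kuhlmann2011]
* F.-V. Kuhlmann, *Elimination of ramification I*, Trans. AMS 362 (2010), §1.1, §2.1.
  [Kuhlmann2010]
* K. Kiyek, J. L. Vicente, *Resolution of curve and surface singularities*, Ch. I (8.3)–(8.4).

## Rendering notes

* `G` is any group acting on the field `N` by ring automorphisms (`MulSemiringAction G N`); the
  pointwise action on `ValuationSubring N` is Mathlib's `ValuationSubring.pointwiseMulAction`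
  (scoped `Pointwise`). Finite order is `IsOfFinOrder g` (automatic for finite `G`).
-/

noncomputable section

open scoped Pointwise

namespace Literature.AlgebraicGeometry.Resolution

universe u

variable {N : Type u} [Field N]

/-! ### Overrings are totally ordered; transfer of valuation inequalities -/

section Order

/-- The valuation subrings of `N` containing a fixed valuation subring `W` are totally ordered by
inclusion (Mathlib's `ValuationSubring.le_total_ideal`, unbundled). [folklore] -/
theorem overring_le_or_ge {W U₁ U₂ : ValuationSubring N} (h₁ : W ≤ U₁) (h₂ : W ≤ U₂) :
    U₁ ≤ U₂ ∨ U₂ ≤ U₁ := by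
  rcases (ValuationSubring.le_total_ideal W).total ⟨U₁, h₁⟩ ⟨U₂, h₂⟩ with h | h
  · exact Or.inl h
  · exact Or.inr h

/-- For a coarsening `W ≤ U`, the maximal ideal of `U` is contained in that of `W`:
`U.valuation x < 1 → W.valuation x < 1`. [folklore] -/
theorem valuation_lt_one_of_le_of_lt_one {W U : ValuationSubring N} (h : W ≤ U) {x : N}
    (hx : U.valuation x < 1) : W.valuation x < 1 :=
  (ValuationSubring.mem_nonunits_iff (A := W)).mp
    (ValuationSubring.nonunits_le_nonunits.mpr h ((ValuationSubring.mem_nonunits_iff (A := U)).mpr hx))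

/-- Coarsening is monotone on values: `W.valuation x ≤ W.valuation y → U.valuation x ≤ U.valuation y`
for `W ≤ U`. [folklore] -/
theorem valuation_le_valuation_of_le {W U : ValuationSubring N} (h : W ≤ U) {x y : N}
    (hxy : W.valuation x ≤ W.valuation y) : U.valuation x ≤ U.valuation y := by
  have := ValuationSubring.monotone_mapOfLE W U h hxy
  rwa [ValuationSubring.mapOfLE_valuation_apply, ValuationSubring.mapOfLE_valuation_apply] at this

/-- Strict inequalities of values descend along a coarsening `W ≤ U`:
`U.valuation x < U.valuation y → W.valuation x < W.valuation y`. [folklore] -/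
theorem valuation_lt_of_lt_of_le {W U : ValuationSubring N} (h : W ≤ U) {x y : N}
    (hxy : U.valuation x < U.valuation y) : W.valuation x < W.valuation y :=
  lt_of_not_ge fun hyx => not_le_of_gt hxy (valuation_le_valuation_of_le h hyx)

/-- An element outside a valuation subring `V` has no power `x ^ (n+1)` inside `V`. [folklore] -/
theorem pow_succ_not_mem {V : ValuationSubring N} {x : N} (hx : x ∉ V) (n : ℕ) :
    x ^ (n + 1) ∉ V := by
  intro hxn
  have hx0 : x ≠ 0 := by rintro rfl; exact hx V.zero_mem
  have hxi : x⁻¹ ∈ V := (V.mem_or_inv_mem x).resolve_left hx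
  apply hx
  have : x = x ^ (n + 1) * (x⁻¹) ^ n := by
    rw [pow_succ, inv_pow, mul_assoc, mul_comm x, ← mul_assoc, mul_inv_cancel₀ (pow_ne_zero n hx0),
      one_mul]
  rw [this]
  exact V.mul_mem _ _ hxn (V.pow_mem hxi n)

end Order

/-! ### Automorphisms of finite order acting on valuation subrings -/

section Action

variable {G : Type*} [Group G] [MulSemiringAction G N]

/-- If `g` has finite order and `g • U ≤ U` then `g • U = U` (conjugate comparable valuation
rings are equal: iterate `g`). [folklore] -/
theorem smul_eq_of_smul_le {g : G} (hg : IsOfFinOrder g) {U : ValuationSubring N}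
    (h : g • U ≤ U) : g • U = U := by
  have hC : ∀ k : ℕ, g ^ k • U ≤ U := by
    intro k
    induction k with
    | zero => simp
    | succ k ih =>
      rw [pow_succ', mul_smul]
      exact (ValuationSubring.pointwise_smul_le_pointwise_smul_iff.mpr ih).trans h
  obtain ⟨n, hn, hgn⟩ := hg.exists_pow_eq_one
  refine le_antisymm h ?_
  obtain ⟨m, rfl⟩ := Nat.exists_eq_succ_of_ne_zero hn.ne'
  calc U = g ^ (m + 1) • U := by rw [hgn, one_smul]
    _ = g • (g ^ m • U) := by rw [pow_succ', mul_smul]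
    _ ≤ g • U := ValuationSubring.pointwise_smul_le_pointwise_smul_iff.mpr (hC m)

/-- If `g` has finite order and `U ≤ g • U` then `g • U = U`. [folklore] -/
theorem smul_eq_of_le_smul {g : G} (hg : IsOfFinOrder g) {U : ValuationSubring N}
    (h : U ≤ g • U) : g • U = U := by
  have h' : g⁻¹ • U ≤ U := ValuationSubring.subset_pointwise_smul_iff.mp h
  have := smul_eq_of_smul_le hg.inv h'
  conv_lhs => rw [← this]
  rw [smul_inv_smul]

/-- If a valuation subring `U` contains both `W` and its conjugate `g • W` (`g` of finite order),
then `g` stabilises `U`: the two overrings `U`, `g • U` of `g • W` are comparable, hence equal.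
(Kuhlmann 2011, proof of Lemma 2.1.) [cite: Kuhlmann2011, Lemma 2.1] -/
theorem smul_eq_of_le_of_smul_le {g : G} (hg : IsOfFinOrder g) {W U : ValuationSubring N}
    (hW : W ≤ U) (hgW : g • W ≤ U) : g • U = U := by
  have h1 : g • W ≤ g • U := ValuationSubring.pointwise_smul_le_pointwise_smul_iff.mpr hW
  rcases overring_le_or_ge hgW h1 with h | h
  · exact smul_eq_of_le_smul hg h
  · exact smul_eq_of_smul_le hg h

/-- The decomposition group grows along coarsenings: if `g • W = W`, `g` of finite order, and
`W ≤ U`, then `g • U = U` (Kuhlmann 2011, Lemma 2.1: "`v ∘ σ = v` implies `w ∘ σ = w`, hence the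
decomposition group with respect to `v` is contained in the decomposition group with respect
to `w`"). [cite: Kuhlmann2011, Lemma 2.1] -/
theorem mem_stabilizer_of_le {g : G} (hg : IsOfFinOrder g) {W U : ValuationSubring N}
    (hW : W ≤ U) (hgW : g • W = W) : g • U = U :=
  smul_eq_of_le_of_smul_le hg hW (hgW.le.trans hW)

/-- Membership is transported by a stabilising automorphism: `g • x ∈ W ↔ x ∈ W` when
`g • W = W`. [folklore] -/
theorem smul_mem_iff_of_smul_eq {g : G} {W : ValuationSubring N} (hgW : g • W = W) (x : N) :
    g • x ∈ W ↔ x ∈ W := by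
  conv_lhs => rw [← hgW]
  exact ValuationSubring.smul_mem_pointwise_smul_iff

/-- A stabilising automorphism preserves the ORDER of values:
`W.valuation (g • x) ≤ W.valuation (g • y) ↔ W.valuation x ≤ W.valuation y` when `g • W = W`.
[folklore] -/
theorem valuation_smul_le_valuation_smul_iff {g : G} {W : ValuationSubring N} (hgW : g • W = W)
    (x y : N) : W.valuation (g • x) ≤ W.valuation (g • y) ↔ W.valuation x ≤ W.valuation y := by
  rw [ValuationSubring.valuation_le_iff, ValuationSubring.valuation_le_iff]
  constructor
  · rintro ⟨a, ha⟩
    refine ⟨⟨g⁻¹ • (a : N), ?_⟩, ?_⟩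
    · rw [← ValuationSubring.mem_pointwise_smul_iff_inv_smul_mem, hgW]
      exact a.2
    · have := congrArg (fun z => g⁻¹ • z) ha
      simpa only [smul_mul', inv_smul_smul] using this
  · rintro ⟨a, ha⟩
    refine ⟨⟨g • (a : N), ?_⟩, ?_⟩
    · exact (smul_mem_iff_of_smul_eq hgW _).mpr a.2
    · change g • (a : N) * g • y = g • x
      rw [← smul_mul', ha]

/-- Strict version of `valuation_smul_le_valuation_smul_iff`. [folklore] -/
theorem valuation_smul_lt_valuation_smul_iff {g : G} {W : ValuationSubring N} (hgW : g • W = W)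
    (x y : N) : W.valuation (g • x) < W.valuation (g • y) ↔ W.valuation x < W.valuation y := by
  rw [lt_iff_not_ge, lt_iff_not_ge, valuation_smul_le_valuation_smul_iff hgW]

/-- `W.valuation (g • x) < 1 ↔ W.valuation x < 1` when `g • W = W`. [folklore] -/
theorem valuation_smul_lt_one_iff_of_smul_eq {g : G} {W : ValuationSubring N} (hgW : g • W = W) (x : N) :
    W.valuation (g • x) < 1 ↔ W.valuation x < 1 := by
  have := valuation_smul_lt_valuation_smul_iff hgW x 1
  rwa [smul_one, map_one] at this

/-- `1 < W.valuation (g • x) ↔ 1 < W.valuation x` when `g • W = W`. [folklore] -/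
theorem one_lt_valuation_smul_iff {g : G} {W : ValuationSubring N} (hgW : g • W = W) (x : N) :
    1 < W.valuation (g • x) ↔ 1 < W.valuation x := by
  have := valuation_smul_lt_valuation_smul_iff hgW 1 x
  rwa [smul_one, map_one] at this

/-- No element has strictly increasing values along the powers of a stabilising automorphism of
finite order. [folklore] -/
theorem not_valuation_lt_valuation_smul {g : G} (hg : IsOfFinOrder g) {U : ValuationSubring N}
    (hgU : g • U = U) (x : N) : ¬ U.valuation x < U.valuation (g • x) := by
  intro hx
  have hstab : ∀ k : ℕ, g ^ k • U = U := fun k =>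
    Subgroup.pow_mem (MulAction.stabilizer G U) (MulAction.mem_stabilizer_iff.mpr hgU) k
  have step : ∀ k : ℕ, U.valuation x < U.valuation (g ^ (k + 1) • x) := by
    intro k
    induction k with
    | zero => simpa using hx
    | succ k ih =>
      have h1 : U.valuation (g ^ (k + 1) • x) < U.valuation (g ^ (k + 1) • g • x) :=
        (valuation_smul_lt_valuation_smul_iff (hstab (k + 1)) x (g • x)).mpr hx
      rw [← mul_smul, ← pow_succ] at h1
      exact ih.trans h1
  obtain ⟨n, hn, hgn⟩ := hg.exists_pow_eq_one
  obtain ⟨m, rfl⟩ := Nat.exists_eq_succ_of_ne_zero hn.ne'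
  have := step m
  rw [hgn, one_smul] at this
  exact lt_irrefl _ this

/-- **An automorphism of finite order stabilising `U` preserves the valuation of `U` exactly**:
`U.valuation (g • a) = U.valuation a` (Kiyek–Vicente I (8.3)(5) with (8.4): the induced order
automorphism of the value group has finite order, hence is the identity). [folklore] -/
theorem valuation_smul_eq {g : G} (hg : IsOfFinOrder g) {U : ValuationSubring N} (hgU : g • U = U)
    (a : N) : U.valuation (g • a) = U.valuation a := by
  refine le_antisymm (not_lt.mp (not_valuation_lt_valuation_smul hg hgU a)) (not_lt.mp fun h => ?_)
  have hgU' : g⁻¹ • U = U := inv_smul_eq_iff.mpr hgU.symm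
  refine not_valuation_lt_valuation_smul hg.inv hgU' (g • a) ?_
  rwa [inv_smul_smul]

/-- For `g` of finite order stabilising `U` and `a ≠ 0`, the ratio `g • a / a` is a unit of `U`
(both it and its inverse lie in `U`). [folklore] -/
theorem smul_div_self_mem {g : G} (hg : IsOfFinOrder g) {U : ValuationSubring N} (hgU : g • U = U)
    {a : N} (ha : a ≠ 0) : g • a / a ∈ U ∧ a / (g • a) ∈ U := by
  have hga : g • a ≠ 0 := by
    intro h
    apply ha
    have := congrArg (fun z => g⁻¹ • z) h
    simpa using this
  have hv := valuation_smul_eq hg hgU a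
  constructor
  · rw [← U.valuation_le_one_iff, map_div₀, hv, div_self ((map_ne_zero U.valuation).mpr ha)]
  · rw [← U.valuation_le_one_iff, map_div₀, hv, div_self ((map_ne_zero U.valuation).mpr ha)]

end Action

/-! ### Large elements below a common coarsening -/

section Large

/-- **Large elements.** Let `V ≤ W'` be valuation subrings of `N`, `e ∈ W' ∖ V`, and `R` a subring
of `N` contained in no valuation subring `U` with `V ≤ U ≤ W'`, `U ≠ W'` (i.e. the join of `V`
and `R` is `W'`). Then some `x ∈ R` satisfies `x ∉ V` and `x / e ∉ V`, i.e. `v(x) > v(e)` for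
the valuation `v` of `V`: the values of elements of `R` are cofinal in the convex subgroup of
`W'`. Proof: the radical `𝔮` of the ideal `e⁻¹ V` is prime (ideals of `V` are totally
ordered), `V_𝔮 ≤ W'` because `𝔪_{W'} ∩ V ⊆ e⁻¹V`, and `e ∉ V_𝔮`; so some `x ∈ R` lies outside
`V_𝔮`, whence `x⁻¹ ∈ 𝔮`, `e = b xⁿ` with `b ∈ V`, and `xⁿ⁺¹` works. (This replaces the
approximation theorem in Zariski–Samuel's argument, cf. Kuhlmann 2011, §4.)
[cite: Kuhlmann2011, Section 4] -/
theorem exists_mem_not_mem_div_not_mem {V W' : ValuationSubring N} (hVW' : V ≤ W') {e : N}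
    (heW' : e ∈ W') (heV : e ∉ V) (R : Subring N)
    (hjoin : ∀ U : ValuationSubring N, V ≤ U → U ≤ W' → U ≠ W' → ∃ r ∈ R, r ∉ U) :
    ∃ x ∈ R, x ∉ V ∧ x / e ∉ V := by
  classical
  have he0 : e ≠ 0 := by rintro rfl; exact heV V.zero_mem
  have hei : e⁻¹ ∈ V := (V.mem_or_inv_mem e).resolve_left heV
  set eV : V := ⟨e⁻¹, hei⟩ with heV_def
  let I : Ideal V := Ideal.span {eV}
  -- `I` is a proper ideal
  have hI : I ≠ ⊤ := by
    intro hI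
    have h1 : (1 : V) ∈ I := by rw [hI]; exact Submodule.mem_top
    obtain ⟨b, hb⟩ := Ideal.mem_span_singleton'.mp h1
    apply heV
    have hbe : (b : N) * e⁻¹ = 1 := by
      have := congrArg (fun z : V => (z : N)) hb
      simpa [heV_def] using this
    have : e = b := by
      have := congrArg (fun z => z * e) hbe
      rwa [mul_assoc, inv_mul_cancel₀ he0, mul_one, one_mul, eq_comm] at this
    rw [this]
    exact b.2
  -- its radical `𝔮` is prime
  let q : Ideal V := I.radical
  have hq : q.IsPrime := by
    rw [show q = I.radical from rfl, Ideal.radical_eq_sInf]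
    obtain ⟨M, hM, hIM⟩ := Ideal.exists_le_maximal I hI
    refine Ideal.sInf_isPrime_of_isChain ⟨M, hIM, hM.isPrime⟩ ?_ fun p hp => hp.2
    intro J₁ _ J₂ _ hne
    rcases (ValuationRing.le_total_ideal (A := V)).total J₁ J₂ with h | h
    · exact Or.inl h
    · exact Or.inr h
  haveI := hq
  -- the coarsening `U = V_𝔮`
  let U : ValuationSubring N := V.ofPrime q
  have hVU : V ≤ U := V.le_ofPrime q
  -- `𝔪_{W'} ∩ V ⊆ I ⊆ 𝔮`, so `U ≤ W'`
  have hideal : V.idealOfLE W' hVW' ≤ q := by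
    intro y hy
    refine Ideal.le_radical (Ideal.mem_span_singleton'.mpr ?_)
    have hy' : W'.valuation (y : N) < 1 := by
      have : (V.inclusion W' hVW' y) ∈ IsLocalRing.maximalIdeal W' := hy
      rw [ValuationSubring.valuation_lt_one_iff] at this
      exact this
    have hye : (y : N) * e ∈ V := by
      rw [← V.valuation_le_one_iff]
      refine le_of_lt (valuation_lt_one_of_le_of_lt_one hVW' ?_)
      rw [map_mul]
      calc W'.valuation y * W'.valuation e ≤ W'.valuation y * 1 := by
            gcongr
            exact (W'.valuation_le_one_iff e).mpr heW'
        _ < 1 := by rwa [mul_one]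
    refine ⟨⟨(y : N) * e, hye⟩, Subtype.ext ?_⟩
    change (y : N) * e * e⁻¹ = y
    rw [mul_assoc, mul_inv_cancel₀ he0, mul_one]
  have hUW' : U ≤ W' := by
    have := V.ofPrime_le_of_le _ _ hideal
    rwa [ValuationSubring.ofPrime_idealOfLE] at this
  -- `e ∉ U`, so `U ≠ W'`
  have heU : e ∉ U := by
    intro heU'
    have h1 : U.valuation e ≤ 1 := (U.valuation_le_one_iff e).mpr heU'
    have h2 : U.valuation (eV : N) ≠ 1 := by
      rw [Ne, ValuationSubring.ofPrime_valuation_eq_one_iff_mem_primeCompl]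
      intro hc
      exact hc (Ideal.le_radical (Ideal.subset_span rfl))
    have h3 : U.valuation (eV : N) ≤ 1 := (U.valuation_le_one_iff _).mpr (hVU eV.2)
    have h4 : U.valuation (e⁻¹ : N) < 1 := lt_of_le_of_ne h3 h2
    rw [map_inv₀, inv_lt_one₀ (zero_lt_iff.mpr ((map_ne_zero U.valuation).mpr he0))] at h4
    exact not_lt_of_ge h1 h4
  have hUne : U ≠ W' := fun h => heU (h ▸ heW')
  -- an element of `R` outside `U`
  obtain ⟨x, hxR, hxU⟩ := hjoin U hVU hUW' hUne
  have hxV : x ∉ V := fun h => hxU (hVU h)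
  have hx0 : x ≠ 0 := by rintro rfl; exact hxV V.zero_mem
  have hxi : x⁻¹ ∈ V := (V.mem_or_inv_mem x).resolve_left hxV
  -- `x⁻¹ ∈ 𝔮`
  have hxq : (⟨x⁻¹, hxi⟩ : V) ∈ q := by
    by_contra hc
    have h1 : U.valuation (x⁻¹ : N) = 1 :=
      (ValuationSubring.ofPrime_valuation_eq_one_iff_mem_primeCompl V q ⟨x⁻¹, hxi⟩).mpr hc
    apply hxU
    rw [← U.valuation_le_one_iff, ← inv_inv x, map_inv₀, h1, inv_one]
  -- so `e = b * x ^ n` with `b ∈ V`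
  obtain ⟨n, hn⟩ := Ideal.mem_radical_iff.mp hxq
  obtain ⟨b, hb⟩ := Ideal.mem_span_singleton'.mp hn
  have hbN : (b : N) * e⁻¹ = (x⁻¹) ^ n := by
    have := congrArg (fun z : V => (z : N)) hb
    simpa [heV_def] using this
  have hexn : (b : N) * x ^ n = e := by
    calc (b : N) * x ^ n = (b : N) * e⁻¹ * (e * x ^ n) := by field_simp
      _ = (x⁻¹) ^ n * (e * x ^ n) := by rw [hbN]
      _ = e := by
        rw [inv_pow, mul_comm, mul_assoc, mul_inv_cancel₀ (pow_ne_zero n hx0), mul_one]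
  -- `x ^ (n+1)` is the required element
  refine ⟨x ^ (n + 1), R.pow_mem hxR _, pow_succ_not_mem hxV n, fun h => hxV ?_⟩
  have : x = x ^ (n + 1) / e * b := by
    rw [div_mul_eq_mul_div, eq_div_iff he0, ← hexn]
    ring
  rw [this]
  exact V.mul_mem _ _ h b.2

end Large

end Literature.AlgebraicGeometry.Resolution
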